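import Summits.ResolutionOfSingularities.ResolutionOfSingularities.Theorems.WeightedInvariantHypersurfaceLocalGameEFTPointMoveExceptional
import Summits.ResolutionOfSingularities.ResolutionOfSingularities.Theorems.WeightedInvariantHypersurfaceLocalGameEFTDimTwoAxisOrder
import Summits.ResolutionOfSingularities.ResolutionOfSingularities.Theorems.WeightedInvariantHypersurfaceLocalGameEFTDimTwoSubSlopeOrder
import HarnessLib

/-!
# The e.f.t. local weighted game (H2a′), dim-2 rung, case C II: the order of the transform at an exceptional
# non-vertex prime («sub-integral first slope», kernel K3b-iii)

Topic: `Summits/ResolutionOfSingularities/ResolutionOfSingularities/Theorems`. Helper for the door item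
`HypersurfaceCentreConstruction` (statement `stmt-ResolutionOfSingularities-19897`, route `WeightedInvariant`);
kernel **K3b-iii** of res-type-098's dim-2 design memo `L/res-type-098-w43/EFT-DIM2-DESIGN.md` v2 §2 row C / §B
(ORDER (o13) of `res-L1-w43-plan-1`), for THE named rank `ι = iotaOrd` (p502169). Hand: res-type-013 (DEALS
2026-08-27T07:02:44Z (3)). Inputs BY NAME: K3a `…EFTPointMoveChart` (p507345: `rho`, `nbar`, `uT`, `transform`,
`rho_transform`, `transform_unique`), K3b-i `…EFTPointMoveExceptional` (p508930: `isRegularLocalRing_of_isLocalization`,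
`psi`, `psi_rho`, `isLocalization_quotient_span_tInv`, `adicOrder_tInv_eq_one`), K3b-ii `…EFTDimTwoAxisOrder`
(p509317/p510480, res-D-pv-036: `algebraMap_X_one_not_mem_sq`), and res-type-025's `…EFTDimTwoSubSlopeOrder`
(`sum_monomial_not_mem_pow`, `monomial_mem_pow`, `mem_sup_span_singleton_iff_mk_mem_map`).

[OURS · L1 W4.3] Replaces the role of NO printed item; NOT a statement of the manuscript
[claim: Hironaka2017, status: under-review]. AI work, weaker than expert review.

## Content (no definitions)

Setting of K3a with `d = 2`: `S` regular local, `u = (u₀, u₁)` a regular system of parameters (`(u) = 𝔪`,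
`spanFinrank 𝔪 = 2`), POSITIVE weights `w` (the memo's case C is `w = (1, b)`; K7 instantiates), `B = S[t⁻¹, 𝒥ₙtⁿ]`,
`uᵢ' = uᵢ t^{wᵢ}`, a `Δ`-expansion `f = Σ_{α∈Δ} a_α u^α + r` with UNIT coefficients, `r ∈ 𝔪ᴺ`, `m ≤ w·α` on `Δ`,
`G = transform …` K3a's saturated transform.
* `forall_sub_not_mem_sq_uT_one` — at a prime `𝔫 ∋ t⁻¹` with `X₁ ∈ n̄ = rho(𝔫)`, in EVERY localisation `L` of `B` at
  `𝔫` (abstract `[IsLocalization.AtPrime L 𝔫]`, as in K3b-i): `u₁' - c·t⁻¹ ∉ 𝔪_L²` for all `c` (K3b-ii's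
  `ord_{n̄}(X₁) = 1` transported through K3b-i's `L/(t⁻¹) ≅ κ[X]_{n̄}`);
* **`iotaOrd_transform_eq`** — if moreover `u₀' ∉ 𝔫`: `iotaOrd L G = n₀`, `n₀ + m = min_{α∈Δ} (α 1 + w·α)` (`< N`): the
  terms of `G` are `(unit)·(u₁')^{α 1}·(t⁻¹)^{w·α−m}` with pairwise distinct exponent pairs (`sum_monomial_not_mem_pow`);
* `rho_transform_eq_C_mul_X_pow`, `…_ne_zero`, `uT_one_mem_of_transform_mem`, `uT_zero_not_mem_of_transform_mem` — when
  the `w`-face of `Δ` at level `m` is ONE exponent `α₀` with `α₀ 0 = 0` (face `ā·X₁^ν`, the memo's `b < β*`), a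
  transform lying in `𝔫` forces `u₁' ∈ 𝔫` and, off the vertex, `u₀' ∉ 𝔫`;
* **`iotaOrd_eq_of_face_X_pow`** — hence EVERY saturated equation `f = (t⁻¹)^{a'} g`, `t⁻¹ ∤ g`, `g ∈ 𝔫`, has `a' = m`,
  `g = G`, `iotaOrd L g = n₀` (`= min_Δ (α₀ + (b+1)α₁) − bν` for `w = (1,b)`, `m = bν`);
* **`subSlope_pointMove_iotaOrd_lt`** — the successor half of the H2a′ clause for the move `(u, w)` in K7a's shape
  (`… → iotaOrd B_𝔫 g < ν`), from the face hypothesis, a witness `α ∈ Δ` with `α 1 + w·α < ν + m` (`β* < b + 1`)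
  and `ν + m ≤ N`.
Elaboration note: generic-ring lemmas and quotients are used only at an ABSTRACT localisation `L`; `Localization.AtPrime 𝔫`
of the subalgebra type appears only in the last theorem, by specialisation (instance diamond recorded in K3b-i).

## References

* J. Włodarczyk, *Functorial resolution by torus actions*, arXiv:2203.03090, §3.3, Lemma 4.1.7. [Wlodarczyk2022]
* O. Zariski, P. Samuel, *Commutative Algebra* II, Ch. VIII §1 Thm. 1 (order valuation). [ZariskiSamuel1960]
-/

noncomputable section

open IsLocalRing Literature.AlgebraicGeometry.Resolution
open Summit.ResolutionOfSingularities.ResolutionOfSingularities.Cruxes.HypersurfaceCentreConstruction.LocalEngine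
  (iotaOrd iotaOrd_eq_natCast_iff)

set_option linter.dupNamespace false -- mandated namespace of this single-conjunct summit

namespace Summit.ResolutionOfSingularities.ResolutionOfSingularities.Theorems

namespace LocalGameEFTPointMove

/-! ## Bookkeeping in a local ring: `z - c·t ∉ 𝔪²` for all `c` -/

/-- Bookkeeping: `(∀ c, z - c·t ∉ 𝔪²)` implies `z̄ ∉ 𝔪̄²` in `R/(t)` (hypothesis shape of `sum_monomial_not_mem_pow`).
[folklore] -/
theorem mk_not_mem_map_sq_of_forall_sub {R : Type*} [CommRing R] [IsLocalRing R] {t z : R}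
    (h : ∀ c : R, z - c * t ∉ maximalIdeal R ^ 2) :
    Ideal.Quotient.mk (Ideal.span {t}) z ∉ ((maximalIdeal R).map (Ideal.Quotient.mk (Ideal.span {t}))) ^ 2 := by
  intro hmem
  rw [← Ideal.map_pow, ← LocalGameEFTSubSlope.mem_sup_span_singleton_iff_mk_mem_map] at hmem
  obtain ⟨y, hy, x, hx, hyx⟩ := Submodule.mem_sup.mp hmem
  obtain ⟨c, rfl⟩ := Ideal.mem_span_singleton'.mp hx
  refine h c ?_
  rw [← hyx, add_sub_cancel_right]
  exact hy

/-- **Transport lemma.** `R` a local ring, `L'` a local (semi)ring, `z y ∈ R`, `e : R/(z) ≃+* L'`; if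
`e ȳ ∉ 𝔪_{L'}²` then `y - c·z ∉ 𝔪_R²` for every `c`. (`L'` is only assumed `CommSemiring`, so that at
`L' = κ[X]_{n̄}` the statement elaborates with the same instances as K3b-ii's.) [folklore] -/
theorem forall_sub_not_mem_sq_of_equiv {R L' : Type*} [CommRing R] [IsLocalRing R] [CommSemiring L'] [IsLocalRing L']
    {z y : R} (e : (R ⧸ Ideal.span {z}) ≃+* L')
    (hy : e (Ideal.Quotient.mk (Ideal.span {z}) y) ∉ (maximalIdeal L') ^ 2) :
    ∀ c : R, y - c * z ∉ (maximalIdeal R) ^ 2 := by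
  intro c hmem
  apply hy
  haveI : Nontrivial (R ⧸ Ideal.span {z}) := e.toEquiv.nontrivial
  haveI : IsLocalRing (R ⧸ Ideal.span {z}) :=
    IsLocalRing.of_surjective' (Ideal.Quotient.mk _) Ideal.Quotient.mk_surjective
  have hmap : (maximalIdeal R).map (Ideal.Quotient.mk (Ideal.span {z})) = maximalIdeal (R ⧸ Ideal.span {z}) :=
    IsLocalRing.map_maximalIdeal_of_surjective _ Ideal.Quotient.mk_surjective
  have hyz : Ideal.Quotient.mk (Ideal.span {z}) y = Ideal.Quotient.mk (Ideal.span {z}) (y - c * z) := by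
    rw [Ideal.Quotient.eq, sub_sub_cancel]
    exact Ideal.mul_mem_left _ _ (Ideal.mem_span_singleton_self z)
  have h1 : Ideal.Quotient.mk (Ideal.span {z}) y ∈ maximalIdeal (R ⧸ Ideal.span {z}) ^ 2 := by
    rw [hyz, ← hmap, ← Ideal.map_pow]
    exact Ideal.mem_map_of_mem _ hmem
  have hle : (maximalIdeal (R ⧸ Ideal.span {z})).map e.toRingHom ≤ maximalIdeal L' := by
    rw [Ideal.map_le_iff_le_comap]
    intro x hx
    rw [Ideal.mem_comap, IsLocalRing.mem_maximalIdeal, mem_nonunits_iff]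
    intro hu
    apply (IsLocalRing.mem_maximalIdeal _).mp hx
    simpa using hu.map e.symm
  have h2 := Ideal.mem_map_of_mem e.toRingHom h1
  rw [Ideal.map_pow] at h2
  exact Ideal.pow_right_mono hle 2 h2

variable {S : Type} [CommRing S] [IsRegularLocalRing S] (u : Fin 2 → S) (w : Fin 2 → ℕ)
  (hu : Ideal.span (Set.range u) = maximalIdeal S) (hd : (maximalIdeal S).spanFinrank = 2)
  (hw : ∀ i, 0 < w i)

/-! ## `t⁻¹, u₁'` are independent parameters of `B_𝔫` when `X₁ ∈ n̄` (K3b-i + K3b-ii) -/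

section Localised

variable (𝔫 : Ideal (extReesAlgebra (weightedMonomialIdeal u w))) [𝔫.IsPrime]
  (hT : extReesAlgebra.tInv (weightedMonomialIdeal u w) ∈ 𝔫)
  (L : Type) [CommRing L] [Algebra (extReesAlgebra (weightedMonomialIdeal u w)) L] [IsLocalization.AtPrime L 𝔫]
  [IsLocalRing L]

include hu hd hw hT in
/-- **`u₁' - c·t⁻¹ ∉ 𝔪_L²` for all `c`**, in every localisation `L` of `B` at a prime `𝔫 ∋ t⁻¹` whose image `n̄` in the
exceptional chart contains `X₁`: K3b-ii's `X₁ ∉ 𝔪²_{κ[X]_{n̄}}` (`algebraMap_X_one_not_mem_sq`) read in `L/(t⁻¹)L`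
through K3b-i's `isLocalization_quotient_span_tInv` (`L/(t⁻¹)L ≅ κ[X]_{n̄}` over `psi`, `psi (X₁) = ū₁'`).
[OURS · L1 W4.3 · K3b-iii] -/
theorem forall_sub_not_mem_sq_uT_one
    (hX1 : (MvPolynomial.X 1 : MvPolynomial (Fin 2) (S ⧸ Ideal.span (Set.range u))) ∈ nbar u w hu hd hw 𝔫) :
    ∀ c : L, algebraMap _ L (uT u w 1) - c * algebraMap _ L (extReesAlgebra.tInv (weightedMonomialIdeal u w)) ∉
      (maximalIdeal L) ^ 2 := by
  haveI := nbar_isPrime u w hu hd hw 𝔫 hT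
  -- `κ = S/(u)` is a field (K3b-ii is stated over a field)
  haveI : (Ideal.span (Set.range u)).IsMaximal := by rw [hu]; exact IsLocalRing.maximalIdeal.isMaximal S
  letI : Field (S ⧸ Ideal.span (Set.range u)) := Ideal.Quotient.field _
  letI := (psi u w hu hd hw L).toAlgebra
  haveI := isLocalization_quotient_span_tInv u w hu hd hw 𝔫 L (nbar u w hu hd hw 𝔫)
    (comap_rho_nbar u w hu hd hw 𝔫 hT).symm
  haveI : Nontrivial (L ⧸ Ideal.span {algebraMap (extReesAlgebra (weightedMonomialIdeal u w)) L
      (extReesAlgebra.tInv (weightedMonomialIdeal u w))}) :=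
    Ideal.Quotient.nontrivial_iff.mpr (Ideal.span_singleton_ne_top
      ((IsLocalization.AtPrime.to_map_mem_maximal_iff L 𝔫 _).mpr hT))
  haveI : IsLocalRing (L ⧸ Ideal.span {algebraMap (extReesAlgebra (weightedMonomialIdeal u w)) L
      (extReesAlgebra.tInv (weightedMonomialIdeal u w))}) :=
    IsLocalRing.of_surjective' (Ideal.Quotient.mk _) Ideal.Quotient.mk_surjective
  let e := IsLocalization.algEquiv (nbar u w hu hd hw 𝔫).primeCompl
    (L ⧸ Ideal.span {algebraMap (extReesAlgebra (weightedMonomialIdeal u w)) L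
      (extReesAlgebra.tInv (weightedMonomialIdeal u w))})
    (Localization.AtPrime (nbar u w hu hd hw 𝔫))
  refine forall_sub_not_mem_sq_of_equiv (L' := Localization.AtPrime (nbar u w hu hd hw 𝔫)) e.toRingEquiv ?_
  have he : e.toRingEquiv (Ideal.Quotient.mk _ (algebraMap (extReesAlgebra (weightedMonomialIdeal u w)) L (uT u w 1))) =
      algebraMap (MvPolynomial (Fin 2) (S ⧸ Ideal.span (Set.range u))) (Localization.AtPrime (nbar u w hu hd hw 𝔫))
        (MvPolynomial.X 1) := by
    rw [← rho_uT u w hu hd hw 1, ← psi_rho u w hu hd hw L, AlgEquiv.coe_ringEquiv, rho_uT]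
    exact e.commutes (MvPolynomial.X 1)
  rw [he]
  exact algebraMap_X_one_not_mem_sq (κ := S ⧸ Ideal.span (Set.range u)) (nbar u w hu hd hw 𝔫) hX1

include hw in
/-- Injectivity of the exponent bookkeeping `α ↦ (α 1, w·α − m)` on `{α | m ≤ w·α}` (two variables, `w 0 > 0`).
[folklore] -/
theorem injOn_exponents (Δ : Finset (Fin 2 → ℕ)) (m : ℕ) (hm : ∀ α ∈ Δ, m ≤ ∑ i, w i * α i) :
    Set.InjOn (fun α : Fin 2 → ℕ => (α 1, (∑ i, w i * α i) - m)) Δ := by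
  intro α hα α' hα' h
  simp only [Prod.mk.injEq] at h
  obtain ⟨h1, h2⟩ := h
  have hsum : ∑ i, w i * α i = ∑ i, w i * α' i := by have := hm α hα; have := hm α' hα'; omega
  rw [Fin.sum_univ_two, Fin.sum_univ_two, h1] at hsum
  have h0 : w 0 * α 0 = w 0 * α' 0 := Nat.add_right_cancel hsum
  have h0' : α 0 = α' 0 := Nat.eq_of_mul_eq_mul_left (hw 0) h0
  funext i
  fin_cases i <;> assumption

/-! ## The order of the saturated transform at a prime `𝔫 ∋ t⁻¹, u₁'` with `u₀' ∉ 𝔫` -/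

include hu hd hw hT in
/-- **The order of the saturated transform at an exceptional prime through `u₁' = 0`, off `u₀' = 0`** (the
«bidegree count» of case C of the dim-2 move table). `𝔫` a prime of `B` with `t⁻¹, u₁' ∈ 𝔫`, `u₀' ∉ 𝔫`, `L` any
localisation of `B` at `𝔫`; `G = Σ_{α∈Δ} a_α (t⁻¹)^{w·α−m} u'^α + (t⁻¹)^{N−m}(r tᴺ)` K3a's `transform` of a
`Δ`-expansion with UNIT coefficients (`m ≤ w·α` on `Δ`); `n₀ + m = min_{α∈Δ} (α 1 + w·α)` with `n₀ + m < N`.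
Then `iotaOrd L G = n₀`. Structural inputs: `L` regular local and `ord_L(t⁻¹) = 1` (K3b-i), `u₁' - c·t⁻¹ ∉ 𝔪_L²`
(`forall_sub_not_mem_sq_uT_one`); counting: `LocalGameEFTSubSlope.sum_monomial_not_mem_pow` with `z₁ = u₁'`,
`z₂ = t⁻¹`, exponents `(α 1, w·α − m)`, units `a_α·(u₀')^{α 0}`. [OURS · L1 W4.3 · K3b-iii] -/
theorem iotaOrd_transform_eq (hY : uT u w 1 ∈ 𝔫) (hX : uT u w 0 ∉ 𝔫)
    (Δ : Finset (Fin 2 → ℕ)) (a : (Fin 2 → ℕ) → S) (ha : ∀ α ∈ Δ, IsUnit (a α)) (m : ℕ) {N : ℕ}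
    (hN : 0 < N) {r : S} (hr : r ∈ (maximalIdeal S) ^ N) (hm : ∀ α ∈ Δ, m ≤ ∑ i, w i * α i)
    (n₀ : ℕ) (hle : ∀ α ∈ Δ, n₀ + m ≤ α 1 + ∑ i, w i * α i)
    (hex : ∃ α ∈ Δ, α 1 + ∑ i, w i * α i = n₀ + m) (hNn : n₀ + m < N) :
    iotaOrd L (algebraMap _ L (transform u w hu hw Δ a m hN hr)) = n₀ := by
  classical
  haveI hreg : IsRegularLocalRing L := isRegularLocalRing_of_isLocalization u w hu hd hw 𝔫 hT L
  have hz₂ : algebraMap _ L (extReesAlgebra.tInv (weightedMonomialIdeal u w)) ∈ maximalIdeal L :=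
    (IsLocalization.AtPrime.to_map_mem_maximal_iff L 𝔫 _).mpr hT
  have hz₁ : algebraMap _ L (uT u w 1) ∈ maximalIdeal L :=
    (IsLocalization.AtPrime.to_map_mem_maximal_iff L 𝔫 _).mpr hY
  have hXu : IsUnit (algebraMap _ L (uT u w 0)) :=
    IsLocalization.map_units L (⟨uT u w 0, hX⟩ : 𝔫.primeCompl)
  have hT2 : algebraMap _ L (extReesAlgebra.tInv (weightedMonomialIdeal u w)) ∉ (maximalIdeal L) ^ 2 :=
    (adicOrder_le_iff _ 1).mp (adicOrder_tInv_eq_one u w hu hd hw 𝔫 hT L).le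
  have hX1 : (MvPolynomial.X 1 : MvPolynomial (Fin 2) (S ⧸ Ideal.span (Set.range u))) ∈ nbar u w hu hd hw 𝔫 := by
    simpa only [rho_uT] using Ideal.mem_map_of_mem (rho u w hu hd hw) hY
  have hY2' := mk_not_mem_map_sq_of_forall_sub (forall_sub_not_mem_sq_uT_one u w hu hd hw 𝔫 hT L hX1)
  -- unit coefficients `v α = a_α · (u₀')^{α 0}` in `L`
  obtain ⟨v, hv⟩ : ∃ v : (Fin 2 → ℕ) → L, ∀ α, v α =
      algebraMap _ L (algebraMap S (extReesAlgebra (weightedMonomialIdeal u w)) (a α)) *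
        algebraMap _ L (uT u w 0) ^ α 0 := ⟨_, fun _ => rfl⟩
  have hvu : ∀ α ∈ Δ, IsUnit (v α) := fun α hα => by
    rw [hv]
    exact (((ha α hα).map (algebraMap S (extReesAlgebra (weightedMonomialIdeal u w)))).map
      (algebraMap _ L)).mul (hXu.pow _)
  -- the transform in `L`
  have hψg : algebraMap _ L (transform u w hu hw Δ a m hN hr) =
      ∑ α ∈ Δ, v α * algebraMap _ L (uT u w 1) ^ α 1 *
          algebraMap _ L (extReesAlgebra.tInv (weightedMonomialIdeal u w)) ^ (∑ i, w i * α i - m) +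
        algebraMap _ L (extReesAlgebra.tInv (weightedMonomialIdeal u w)) ^ (N - m) *
          algebraMap _ L (rT u w hu hw hN hr) := by
    simp only [transform, map_add, map_sum, map_mul, map_pow, Fin.prod_univ_two, hv]
    congr 1
    refine Finset.sum_congr rfl fun α _ => ?_
    ring
  -- the polynomial part has order exactly `n₀`
  have hle' : ∀ α ∈ Δ, n₀ ≤ α 1 + (∑ i, w i * α i - m) := fun α hα => by have := hle α hα; have := hm α hα; omega
  have hex' : ∃ α ∈ Δ, α 1 + (∑ i, w i * α i - m) = n₀ := by
    obtain ⟨α, hα, h⟩ := hex; exact ⟨α, hα, by have := hm α hα; omega⟩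
  have hmain := LocalGameEFTSubSlope.sum_monomial_not_mem_pow hz₁ hz₂ hT2 hY2' (fun α : Fin 2 → ℕ => α 1) v n₀ Δ
    (fun α => ∑ i, w i * α i - m) (injOn_exponents w hw Δ m hm) hvu hle' hex'
  -- the remainder lies in `𝔪^{n₀+1}`
  have hrem : algebraMap _ L (extReesAlgebra.tInv (weightedMonomialIdeal u w)) ^ (N - m) *
      algebraMap _ L (rT u w hu hw hN hr) ∈ maximalIdeal L ^ (n₀ + 1) :=
    Ideal.mul_mem_right _ _ (Ideal.pow_le_pow_right (by omega) (Ideal.pow_mem_pow hz₂ _))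
  rw [iotaOrd_eq_natCast_iff, hψg]
  refine ⟨Ideal.add_mem _ (Ideal.sum_mem _ fun α hα => ?_) (Ideal.pow_le_pow_right (Nat.le_succ _) hrem),
    fun hmem => hmain ?_⟩
  · exact Ideal.pow_le_pow_right (hle' α hα) (LocalGameEFTSubSlope.monomial_mem_pow hz₁ hz₂ (v α) _ _)
  · exact (Ideal.add_mem_iff_left _ hrem).mp hmem

end Localised

/-! ## Face `Φ = ā·X₁^ν`: which generators lie in `𝔫` -/

section Face

variable (Δ : Finset (Fin 2 → ℕ)) (a : (Fin 2 → ℕ) → S) (m : ℕ) {N : ℕ} (hN : 0 < N) {r : S}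
  (hr : r ∈ (maximalIdeal S) ^ N) (hm : ∀ α ∈ Δ, m ≤ ∑ i, w i * α i) (hmN : m < N)
  (α₀ : Fin 2 → ℕ) (hα₀ : α₀ ∈ Δ) (hα₀0 : α₀ 0 = 0) (hα₀m : ∑ i, w i * α₀ i = m)
  (hface : ∀ α ∈ Δ, α ≠ α₀ → m < ∑ i, w i * α i)

include hu hd hw hm hmN hα₀ hα₀0 hα₀m hface

/-- When the `w`-face of `Δ` at level `m` is the single exponent `α₀ = (0, ν)`, the face polynomial of the transform is
`rho G = ā_{α₀} · X₁^ν`. [OURS · L1 W4.3 · K3b-iii] -/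
theorem rho_transform_eq_C_mul_X_pow :
    rho u w hu hd hw (transform u w hu hw Δ a m hN hr) =
      MvPolynomial.C (Ideal.Quotient.mk _ (a α₀)) * MvPolynomial.X 1 ^ α₀ 1 := by
  classical
  rw [rho_transform u w hu hd hw Δ a m hN hr hm hmN]
  have hfilter : Δ.filter (fun α => ∑ i, w i * α i = m) = {α₀} := by
    ext α
    simp only [Finset.mem_filter, Finset.mem_singleton]
    constructor
    · rintro ⟨hα, hαm⟩
      by_contra hne
      exact absurd hαm (ne_of_gt (hface α hα hne))
    · rintro rfl; exact ⟨hα₀, hα₀m⟩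
  rw [hfilter, Finset.sum_singleton, Fin.prod_univ_two, hα₀0, pow_zero, one_mul]

/-- … and it is non-zero when `a_{α₀}` is a unit (`S/(u) = κ` is a field, in particular non-trivial).
[OURS · L1 W4.3 · K3b-iii] -/
theorem rho_transform_ne_zero (ha₀ : IsUnit (a α₀)) : rho u w hu hd hw (transform u w hu hw Δ a m hN hr) ≠ 0 := by
  haveI : Nontrivial (S ⧸ Ideal.span (Set.range u)) :=
    Ideal.Quotient.nontrivial_iff.mpr (by rw [hu]; exact (maximalIdeal.isMaximal S).ne_top)
  rw [rho_transform_eq_C_mul_X_pow u w hu hd hw Δ a m hN hr hm hmN α₀ hα₀ hα₀0 hα₀m hface,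
    MvPolynomial.C_mul_X_pow_eq_monomial, Ne, MvPolynomial.monomial_eq_zero]
  exact (ha₀.map (Ideal.Quotient.mk (Ideal.span (Set.range u)))).ne_zero

variable (𝔫 : Ideal (extReesAlgebra (weightedMonomialIdeal u w))) [𝔫.IsPrime]
  (hT : extReesAlgebra.tInv (weightedMonomialIdeal u w) ∈ 𝔫)

include hT

/-- If the transform lies in an exceptional prime `𝔫` (face `ā X₁^ν`, `ā` a unit) then `X₁ ∈ n̄ = rho(𝔫)`.
[OURS · L1 W4.3 · K3b-iii] -/
theorem X_one_mem_nbar_of_transform_mem (ha₀ : IsUnit (a α₀)) (hg : transform u w hu hw Δ a m hN hr ∈ 𝔫) :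
    (MvPolynomial.X 1 : MvPolynomial (Fin 2) (S ⧸ Ideal.span (Set.range u))) ∈ nbar u w hu hd hw 𝔫 := by
  haveI := nbar_isPrime u w hu hd hw 𝔫 hT
  have hmem : rho u w hu hd hw (transform u w hu hw Δ a m hN hr) ∈ nbar u w hu hd hw 𝔫 :=
    Ideal.mem_map_of_mem _ hg
  rw [rho_transform_eq_C_mul_X_pow u w hu hd hw Δ a m hN hr hm hmN α₀ hα₀ hα₀0 hα₀m hface,
    Ideal.unit_mul_mem_iff_mem _ ((ha₀.map (Ideal.Quotient.mk _)).map MvPolynomial.C)] at hmem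
  exact Ideal.IsPrime.mem_of_pow_mem inferInstance _ hmem

/-- Under the same hypotheses `u₁' ∈ 𝔫`. [OURS · L1 W4.3 · K3b-iii] -/
theorem uT_one_mem_of_transform_mem (ha₀ : IsUnit (a α₀)) (hg : transform u w hu hw Δ a m hN hr ∈ 𝔫) :
    uT u w 1 ∈ 𝔫 := by
  rw [← comap_rho_nbar u w hu hd hw 𝔫 hT, Ideal.mem_comap, rho_uT]
  exact X_one_mem_nbar_of_transform_mem u w hu hd hw Δ a m hN hr hm hmN α₀ hα₀ hα₀0 hα₀m hface 𝔫 hT ha₀ hg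

/-- … and OFF THE VERTEX `u₀' ∉ 𝔫` (`X₀ ∉ n̄`: the other generator is a unit of `B_𝔫`). [OURS · L1 W4.3 · K3b-iii] -/
theorem uT_zero_not_mem_of_transform_mem (hV : ¬ extReesAlgebra.vertexIdeal (weightedMonomialIdeal u w) ≤ 𝔫)
    (ha₀ : IsUnit (a α₀)) (hg : transform u w hu hw Δ a m hN hr ∈ 𝔫) : uT u w 0 ∉ 𝔫 := by
  intro h0
  apply not_span_X_le_nbar u w hu hd hw 𝔫 hT hV
  rw [Ideal.span_le]
  rintro _ ⟨i, rfl⟩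
  fin_cases i
  · have := Ideal.mem_map_of_mem (rho u w hu hd hw) h0
    rwa [rho_uT] at this
  · exact X_one_mem_nbar_of_transform_mem u w hu hd hw Δ a m hN hr hm hmN α₀ hα₀ hα₀0 hα₀m hface 𝔫 hT ha₀ hg

end Face

/-! ## The case-C order count, for every saturated equation of the transform -/

include hu hd hw in
/-- **K3b-iii, main statement (case C of the dim-2 rung), in every localisation `L` of `B` at `𝔫`.** `S` regular
local with regular system of parameters `u = (u₀, u₁)` (`(u) = 𝔪`, `spanFinrank 𝔪 = 2`) and positive weights `w`; a
`Δ`-expansion `f = Σ_{α∈Δ} a_α u^α + r` with UNIT coefficients, `r ∈ 𝔪ᴺ`, `m ≤ w·α` on `Δ`, whose `w`-face at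
level `m` is the single exponent `α₀` with `α₀ 0 = 0` (face polynomial `ā·X₁^ν` — the case `b < β*` of the memo);
`n₀ + m = min_Δ (α 1 + w·α) < N`. Then at every prime `𝔫 ∋ t⁻¹` of `B` off the vertex, EVERY factorisation
`f = (t⁻¹)^{a'} g`, `t⁻¹ ∤ g`, with `g ∈ 𝔫` has `a' = m`, `g = G` (K3a's `transform_unique`) and
`iotaOrd L g = n₀` (`= min_Δ (α 0 + (b+1)·α 1) − bν` for `w = (1, b)`, `m = bν`). [OURS · L1 W4.3 · K3b-iii] -/
theorem iotaOrd_eq_of_face_X_pow (Δ : Finset (Fin 2 → ℕ)) (a : (Fin 2 → ℕ) → S) (ha : ∀ α ∈ Δ, IsUnit (a α))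
    (m : ℕ) {N : ℕ} (hN : 0 < N) {r : S} (hr : r ∈ (maximalIdeal S) ^ N) (hm : ∀ α ∈ Δ, m ≤ ∑ i, w i * α i)
    {f : S} (hf : f = ∑ α ∈ Δ, a α * ∏ i, u i ^ α i + r)
    (α₀ : Fin 2 → ℕ) (hα₀ : α₀ ∈ Δ) (hα₀0 : α₀ 0 = 0) (hα₀m : ∑ i, w i * α₀ i = m)
    (hface : ∀ α ∈ Δ, α ≠ α₀ → m < ∑ i, w i * α i)
    (n₀ : ℕ) (hle : ∀ α ∈ Δ, n₀ + m ≤ α 1 + ∑ i, w i * α i)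
    (hex : ∃ α ∈ Δ, α 1 + ∑ i, w i * α i = n₀ + m) (hNn : n₀ + m < N)
    (𝔫 : Ideal (extReesAlgebra (weightedMonomialIdeal u w))) [𝔫.IsPrime]
    (hT : extReesAlgebra.tInv (weightedMonomialIdeal u w) ∈ 𝔫)
    (hV : ¬ extReesAlgebra.vertexIdeal (weightedMonomialIdeal u w) ≤ 𝔫)
    (L : Type) [CommRing L] [Algebra (extReesAlgebra (weightedMonomialIdeal u w)) L] [IsLocalization.AtPrime L 𝔫]
    [IsLocalRing L]
    {a' : ℕ} {g : extReesAlgebra (weightedMonomialIdeal u w)}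
    (hfg : algebraMap S (extReesAlgebra (weightedMonomialIdeal u w)) f =
      extReesAlgebra.tInv (weightedMonomialIdeal u w) ^ a' * g)
    (hndvd : ¬ extReesAlgebra.tInv (weightedMonomialIdeal u w) ∣ g) (hg𝔫 : g ∈ 𝔫) :
    a' = m ∧ g = transform u w hu hw Δ a m hN hr ∧ iotaOrd L (algebraMap _ L g) = n₀ := by
  have hmN : m < N := by omega
  have ha₀ : IsUnit (a α₀) := ha α₀ hα₀
  obtain ⟨rfl, rfl⟩ := transform_unique u w hu hd hw Δ a m hN hr hm hmN hf
    (rho_transform_ne_zero u w hu hd hw Δ a m hN hr hm hmN α₀ hα₀ hα₀0 hα₀m hface ha₀) hfg hndvd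
  exact ⟨rfl, rfl, iotaOrd_transform_eq u w hu hd hw 𝔫 hT L
    (uT_one_mem_of_transform_mem u w hu hd hw Δ a a' hN hr hm hmN α₀ hα₀ hα₀0 hα₀m hface 𝔫 hT ha₀ hg𝔫)
    (uT_zero_not_mem_of_transform_mem u w hu hd hw Δ a a' hN hr hm hmN α₀ hα₀ hα₀0 hα₀m hface 𝔫 hT hV ha₀ hg𝔫)
    Δ a ha a' hN hr hm n₀ hle hex hNn⟩

include hu hd hw in
/-- **K3b-iii in the shape of the H2a′ successor clause** (`ι = iotaOrd`; K7a's binder shape, what K7 consumes for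
case C). Data as in `iotaOrd_eq_of_face_X_pow` (without `n₀`), plus a WITNESS `α ∈ Δ` with `α 1 + w·α < ν + m`
(the memo's `β* < b + 1`; for `w = (1,b)`, `m = bν`: `α 0 + (b+1)·α 1 < (b+1)ν`) and `ν + m ≤ N`. Then the point
move `(u, w)` satisfies: at every prime `𝔫 ∋ t⁻¹` of `B` over `𝔪` off the vertex and every saturated equation `g`
with `g ∈ 𝔪_{B_𝔫}²`, `iotaOrd B_𝔫 g < ν`. (Admissibility, `(u) = 𝔪`, `spanFinrank = 2`, `∃ i, 0 < w i` and
`iotaOrd S f = ν` are the other, move-independent conjuncts of the clause and are not restated.)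
[OURS · L1 W4.3 · K3b-iii] -/
theorem subSlope_pointMove_iotaOrd_lt (Δ : Finset (Fin 2 → ℕ)) (a : (Fin 2 → ℕ) → S)
    (ha : ∀ α ∈ Δ, IsUnit (a α)) (m : ℕ) {N : ℕ} (hN : 0 < N) {r : S} (hr : r ∈ (maximalIdeal S) ^ N)
    (hm : ∀ α ∈ Δ, m ≤ ∑ i, w i * α i)
    {f : S} (hf : f = ∑ α ∈ Δ, a α * ∏ i, u i ^ α i + r)
    (α₀ : Fin 2 → ℕ) (hα₀ : α₀ ∈ Δ) (hα₀0 : α₀ 0 = 0) (hα₀m : ∑ i, w i * α₀ i = m)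
    (hface : ∀ α ∈ Δ, α ≠ α₀ → m < ∑ i, w i * α i)
    (ν : ℕ) (hlt : ∃ α ∈ Δ, α 1 + ∑ i, w i * α i < ν + m) (hNν : ν + m ≤ N) :
    ∀ (𝔫 : Ideal (extReesAlgebra (weightedMonomialIdeal u w))) [𝔫.IsPrime],
      extReesAlgebra.tInv (weightedMonomialIdeal u w) ∈ 𝔫 →
      (maximalIdeal S).map (algebraMap S (extReesAlgebra (weightedMonomialIdeal u w))) ≤ 𝔫 →
      ¬ (extReesAlgebra.vertexIdeal (weightedMonomialIdeal u w) ≤ 𝔫) →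
      ∀ (a' : ℕ) (g : extReesAlgebra (weightedMonomialIdeal u w)),
        algebraMap S (extReesAlgebra (weightedMonomialIdeal u w)) f =
          extReesAlgebra.tInv (weightedMonomialIdeal u w) ^ a' * g →
        ¬ (extReesAlgebra.tInv (weightedMonomialIdeal u w) ∣ g) →
        algebraMap (extReesAlgebra (weightedMonomialIdeal u w)) (Localization.AtPrime 𝔫) g ∈
          (maximalIdeal (Localization.AtPrime 𝔫)) ^ 2 →
        iotaOrd (Localization.AtPrime 𝔫)
          (algebraMap (extReesAlgebra (weightedMonomialIdeal u w)) (Localization.AtPrime 𝔫) g) < ν := by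
  classical
  -- `n₀ + m := min_Δ (α 1 + w·α)`
  obtain ⟨α₁, hα₁, hα₁lt⟩ := hlt
  have hne : (Δ.image fun α : Fin 2 → ℕ => α 1 + ∑ i, w i * α i).Nonempty := ⟨_, Finset.mem_image_of_mem _ hα₁⟩
  set M := (Δ.image fun α : Fin 2 → ℕ => α 1 + ∑ i, w i * α i).min' hne with hM
  have hMle : ∀ α ∈ Δ, M ≤ α 1 + ∑ i, w i * α i := fun α hα =>
    Finset.min'_le _ _ (Finset.mem_image_of_mem _ hα)
  obtain ⟨α₂, hα₂, hα₂M⟩ : ∃ α ∈ Δ, α 1 + ∑ i, w i * α i = M := by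
    simpa only [Finset.mem_image] using Finset.min'_mem _ hne
  have hmM : m ≤ M := by rw [← hα₂M]; have := hm α₂ hα₂; omega
  have hMν : M < ν + m := (hMle α₁ hα₁).trans_lt hα₁lt
  intro 𝔫 _ hT _ hV a' g hfg hndvd hg2
  have hg𝔫 : g ∈ 𝔫 := (IsLocalization.AtPrime.to_map_mem_maximal_iff (Localization.AtPrime 𝔫) 𝔫 g).mp
    (Ideal.pow_le_self two_ne_zero hg2)
  obtain ⟨-, -, hι⟩ := iotaOrd_eq_of_face_X_pow u w hu hd hw Δ a ha m hN hr hm hf α₀ hα₀ hα₀0 hα₀m hface (M - m)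
    (fun α hα => by have := hMle α hα; omega) ⟨α₂, hα₂, by omega⟩ (by omega) 𝔫 hT hV (Localization.AtPrime 𝔫)
    hfg hndvd hg𝔫
  have hlt' : ((M - m : ℕ) : Ordinal) < ν := by exact_mod_cast (by omega : M - m < ν)
  exact lt_of_eq_of_lt hι hlt'

end LocalGameEFTPointMove

end Summit.ResolutionOfSingularities.ResolutionOfSingularities.Theorems

end
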